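import Summits.Schanuel.Schanuel.Theorems.RootDecomp1KHyper14

/-!
# RootDecomp1KHyper — part 15 of the «HyperCarving» port wave (lens 6, gen 9 = ROUND 4 of route-Schanuel-RootDecomp1K; 19 parts planned)

Mechanical port (census-1 gen 7, dependency closure; tools census/tools/gen7/portkit2.py + build_l6g9.py) of §17 of HOME/decomp-schanuel-lens-6/g9/HyperCarving.lean
(sha256 aba5c91f…, 8041 l; critic CLEARED FOR TYPING 2026-08-30T13:33:07Z; writer PATH A″ rev 5–8) together with the §§0–16 declarations it depends on
(nothing of the node was in the tree before except RootDecomp1KLinLiouvilleSplit and the Literature fact NesterenkoWaldschmidt1996_thm_5_1).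
This part: node lines 6484–6843 (20 declarations: hyperLiouville_lambdaH, hyperLiouville_lambdaH_irrational, le_remainder, liouvilleNumber_sub_rat_lower, two_le_exp_one, not_hyperLiouville_liouvilleNumber …).
All parts share the namespace `Summit.Schanuel.Schanuel.Theorems.RootDecomp1KHyper` (node sub-namespace `HyperCell` reproduced); statements and proofs
are the node's verbatim; `--supports stmt-Schanuel-33363` (A₄ʰ HyperLiouvilleSchanuel). Sorry-free; standard axioms. Nothing here proves Schanuel; rung 0.
-/

set_option linter.dupNamespace false
set_option linter.unusedSectionVars false

noncomputable section

open Complex IntermediateField Filter Polynomial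

namespace Summit.Schanuel.Schanuel.Theorems.RootDecomp1KHyper

variable {n K : ℕ}

namespace HyperCell

variable {n K : ℕ}

/-- §17d. An EXPLICIT hyper-Liouville number: λ_H = Σ_k 2^{−a_k}, a₀ = 1, a_{k+1} = 2^{(k+1)·a: auxiliary statement `exp_one_le_three` (lens 6 gen 9 node, ported verbatim). -/
private theorem exp_one_le_three : Real.exp 1 ≤ 3 := by
  have := Real.exp_one_lt_d9; norm_num at this; linarith

/-- `(1/3)^X ≤ exp(−X)`. -/
private theorem third_pow_le_exp_neg (X : ℕ) : ((1 : ℝ) / 3) ^ X ≤ Real.exp (-(X : ℝ)) := by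
  have h1 : (1 : ℝ) / 3 ≤ Real.exp (-1) := by
    rw [Real.exp_neg, ← one_div]
    exact one_div_le_one_div_of_le (Real.exp_pos 1) exp_one_le_three
  calc ((1 : ℝ) / 3) ^ X ≤ Real.exp (-1) ^ X := pow_le_pow_left₀ (by norm_num) h1 X
    _ = Real.exp (-(X : ℝ)) := by rw [← Real.exp_nat_mul]; ring_nf

/-- `2 · 16^{−X} < 3^{−X}` for `X ≥ 1`. -/
private theorem two_mul_sixteenth_pow_lt {X : ℕ} (hX : 1 ≤ X) :
    2 * ((1 : ℝ) / 16) ^ X < ((1 : ℝ) / 3) ^ X := by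
  have e : ((1 : ℝ) / 3) ^ X = ((16 : ℝ) / 3) ^ X * ((1 : ℝ) / 16) ^ X := by
    rw [← mul_pow]; norm_num
  rw [e]
  have h : (2 : ℝ) < ((16 : ℝ) / 3) ^ X :=
    calc (2 : ℝ) < 16 / 3 := by norm_num
      _ ≤ ((16 : ℝ) / 3) ^ X := le_self_pow₀ (by norm_num) (by omega)
  exact mul_lt_mul_of_pos_right h (by positivity)

/-- **`λ_H` is hyper-Liouville** — an explicit, certified witness (no Baire category). -/
theorem hyperLiouville_lambdaH : HyperLiouville lambdaH := by
  intro m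
  -- the approximant: the partial sum with `m + 2` terms, `= M / 2^{a_{m+1}}`, `M` odd
  obtain ⟨M, hModd, hsum⟩ := lambdaH_partialSum (m + 1)
  set A : ℕ := hexp (m + 1) with hA
  have hA1 : 1 ≤ A := one_le_hexp _
  set r : ℚ := (M : ℚ) / ((2 : ℚ) ^ A) with hr
  have hden : r.den = 2 ^ A := by
    have hcop : Nat.Coprime (M : ℤ).natAbs ((2 : ℤ) ^ A).natAbs := by
      rw [Int.natAbs_natCast, Int.natAbs_pow]
      exact Nat.Coprime.pow_right A (Nat.coprime_two_right.mpr hModd)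
    have h := Rat.den_div_eq_of_coprime (a := (M : ℤ)) (b := (2 : ℤ) ^ A) (by positivity) hcop
    have e : ((M : ℤ) : ℚ) / (((2 : ℤ) ^ A : ℤ) : ℚ) = r := by rw [hr]; push_cast; rfl
    rw [e] at h
    exact_mod_cast h
  have hrR : (r : ℝ) = ∑ k ∈ Finset.range (m + 2), 1 / (2 : ℝ) ^ hexp k := by
    rw [hsum, hr]; push_cast; rfl
  -- the tail
  set T : ℝ := ∑' k, 1 / (2 : ℝ) ^ hexp (k + (m + 2)) with hT
  have hlam : lambdaH - r = T := by
    rw [hrR, lambdaH_eq_partialSum_add_tail (m + 2)]; ring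
  have hTpos : 0 < T := lambdaH_tail_pos (m + 2)
  have hTle : T ≤ 2 * (1 / (2 : ℝ) ^ hexp (m + 2)) := lambdaH_tail_le (m + 2)
  refine ⟨r, ?_, ?_, ?_⟩
  · -- `m ≤ den r = 2^A`
    rw [hden]
    calc m ≤ m + 2 := by omega
      _ ≤ A := succ_le_hexp (m + 1)
      _ ≤ 2 ^ A := Nat.lt_two_pow_self.le
  · intro h
    have : lambdaH - r = 0 := by rw [h, sub_self]
    rw [hlam] at this
    exact hTpos.ne' this
  · rw [hlam, abs_of_pos hTpos, hden]
    -- `den^m = 2^{mA} =: X`, `a_{m+2} = 2^{(m+2)A} ≥ 4X`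
    set X : ℕ := 2 ^ (m * A) with hX
    have hX1 : 1 ≤ X := Nat.one_le_two_pow
    have hcast : (((2 ^ A : ℕ) : ℝ)) ^ m = (X : ℝ) := by
      rw [hX]; push_cast; rw [← pow_mul, Nat.mul_comm]
    rw [hcast]
    have h4X : 4 * X ≤ hexp (m + 2) := by
      rw [hexp_succ, hX, ← hA, show 4 * 2 ^ (m * A) = 2 ^ (m * A + 2) by rw [pow_add]; ring]
      exact Nat.pow_le_pow_right (by norm_num) (by nlinarith)
    calc T ≤ 2 * (1 / (2 : ℝ) ^ hexp (m + 2)) := hTle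
      _ ≤ 2 * (1 / (2 : ℝ) ^ (4 * X)) := by
          gcongr
          · norm_num
      _ = 2 * ((1 : ℝ) / 16) ^ X := by
          rw [pow_mul, one_div_pow]; norm_num
      _ < ((1 : ℝ) / 3) ^ X := two_mul_sixteenth_pow_lt hX1
      _ ≤ Real.exp (-(X : ℝ)) := third_pow_le_exp_neg X

/-- So the explicit tuple `(λ_H, λ_H²)` is a hyper-Liouville point (§17c applies to it). -/
theorem hyperLiouville_lambdaH_irrational : Irrational lambdaH := hyperLiouville_lambdaH.irrational

/-- The first term bounds the remainder of a Liouville series from below. -/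
private theorem le_remainder {m : ℝ} (hm : 1 < m) (k : ℕ) :
    1 / m ^ (k + 1).factorial ≤ LiouvilleNumber.remainder m k := by
  have h := (LiouvilleNumber.remainder_summable hm k).le_tsum 0 (fun j _ => by positivity)
  simp only [zero_add] at h
  exact h

/-- **Effective irrationality measure of `liouvilleNumber b`** at rationals of denominator `≥ b`. -/
private theorem liouvilleNumber_sub_rat_lower {b : ℕ} (hb : 2 ≤ b) (r : ℚ) (hq : b ≤ r.den) :
    1 / (2 * (r.den : ℝ) ^ (3 * r.den ^ 2)) ≤ |liouvilleNumber b - r| := by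
  classical
  set q : ℕ := r.den with hqdef
  have hq2 : 2 ≤ q := hb.trans hq
  have hq1R : (1 : ℝ) ≤ q := by exact_mod_cast (show 1 ≤ q by omega)
  have hq0R : (0 : ℝ) < q := by linarith
  have hb1 : 1 < b := by omega
  have hbR1 : (1 : ℝ) < b := by exact_mod_cast hb1
  have hbR2 : (2 : ℝ) ≤ b := by exact_mod_cast hb
  have hbR0 : (0 : ℝ) < b := by linarith
  -- `k ≥ 1` with `b^{k!} ≤ q < b^{(k+1)!}`
  have hex : ∃ j : ℕ, q < b ^ (j + 1).factorial :=
    ⟨q, (Nat.lt_pow_self hb1).trans_le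
      (Nat.pow_le_pow_right (by omega) ((Nat.self_le_factorial _).trans
        (Nat.factorial_le (Nat.le_succ q))))⟩
  set k : ℕ := Nat.find hex with hk
  have hkP : q < b ^ (k + 1).factorial := Nat.find_spec hex
  have hk1 : 1 ≤ k := by
    by_contra h0
    have h00 : k = 0 := by omega
    rw [h00] at hkP
    simp at hkP
    omega
  have hklow : b ^ k.factorial ≤ q := by
    have h := Nat.find_min hex (m := k - 1) (by omega)
    rw [Nat.sub_add_cancel hk1] at h
    exact not_lt.mp h
  -- `k ≤ q`
  have hkq : k ≤ q :=
    (Nat.self_le_factorial k).trans ((Nat.lt_pow_self hb1).le.trans hklow)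
  -- real quantities
  set D : ℝ := (b : ℝ) ^ (k + 1).factorial with hD
  have hD0 : 0 < D := by positivity
  have hqD : (q : ℝ) < D := by rw [hD]; exact_mod_cast hkP
  have hqD' : (q : ℝ) ≤ D := hqD.le
  have hD4 : (4 : ℝ) ≤ D := by
    have h2 : 2 ≤ (k + 1).factorial := (show 2 ≤ k + 1 by omega).trans (Nat.self_le_factorial _)
    calc (4 : ℝ) = 2 ^ 2 := by norm_num
      _ ≤ (b : ℝ) ^ 2 := pow_le_pow_left₀ (by norm_num) hbR2 2
      _ ≤ (b : ℝ) ^ (k + 1).factorial := pow_le_pow_right₀ hbR1.le h2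
  have hDq : D ≤ (q : ℝ) ^ (k + 1) := by
    have e : D = ((b : ℝ) ^ k.factorial) ^ (k + 1) := by
      rw [hD, ← pow_mul, Nat.factorial_succ, Nat.mul_comm]
    rw [e]
    exact pow_le_pow_left₀ (by positivity) (by exact_mod_cast hklow) _
  have hD' : (b : ℝ) ^ (k + 2).factorial = D ^ (k + 2) := by
    rw [hD, ← pow_mul, show k + 2 = (k + 1) + 1 by omega, Nat.factorial_succ (k + 1),
      Nat.mul_comm]
  -- the partial sum `P = p / D` and the remainder `R`
  obtain ⟨p, hp⟩ := LiouvilleNumber.partialSum_eq_rat (by omega : 0 < b) (k + 1)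
  rw [Nat.cast_pow] at hp
  set P : ℝ := LiouvilleNumber.partialSum b (k + 1) with hPdef
  set R : ℝ := LiouvilleNumber.remainder b (k + 1) with hRdef
  have hℓ : liouvilleNumber b = P + R :=
    (LiouvilleNumber.partialSum_add_remainder hbR1 (k + 1)).symm
  have hRpos : 0 < R := LiouvilleNumber.remainder_pos hbR1 (k + 1)
  have hRlt : R < 1 / (2 * D ^ 2) := by
    have h1 := LiouvilleNumber.remainder_lt' (k + 1) hbR1
    have h2 : (1 - 1 / (b : ℝ))⁻¹ * (1 / (b : ℝ) ^ (k + 1 + 1).factorial) ≤ 2 * (1 / D ^ (k + 2)) := by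
      rw [show k + 1 + 1 = k + 2 by omega, hD']
      gcongr
      exact sub_one_div_inv_le_two hbR2
    have h3 : 2 * (1 / D ^ (k + 2)) ≤ 2 * (1 / D ^ 3) := by
      gcongr
      · exact le_trans (by norm_num) hD4
      · omega
    have h4 : 2 * (1 / D ^ 3) ≤ 1 / (2 * D ^ 2) := by
      rw [mul_one_div, div_le_div_iff₀ (by positivity) (by positivity)]
      nlinarith [hD4, hD0]
    linarith
  have hRge : 1 / D ^ (k + 2) ≤ R := by
    rw [← hD', hRdef, show k + 2 = (k + 1) + 1 by omega]
    exact le_remainder hbR1 (k + 1)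
  -- the final exponent bookkeeping: `(k+1)(k+2) ≤ 3q²`, `k + 2 ≤ 3q²`
  have hexp1 : (k + 1) * (k + 2) ≤ 3 * q ^ 2 := by nlinarith
  have hexp2 : k + 2 ≤ 3 * q ^ 2 := by nlinarith
  have hfin1 : 1 / (q : ℝ) ^ ((k + 1) * (k + 2)) ≥ 1 / (2 * (q : ℝ) ^ (3 * q ^ 2)) := by
    apply one_div_le_one_div_of_le (by positivity)
    calc (q : ℝ) ^ ((k + 1) * (k + 2)) ≤ (q : ℝ) ^ (3 * q ^ 2) := pow_le_pow_right₀ hq1R hexp1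
      _ ≤ 2 * (q : ℝ) ^ (3 * q ^ 2) := by linarith [pow_nonneg hq0R.le (3 * q ^ 2)]
  have hfin2 : 1 / (2 * (q : ℝ) ^ (k + 2)) ≥ 1 / (2 * (q : ℝ) ^ (3 * q ^ 2)) := by
    apply one_div_le_one_div_of_le (by positivity)
    exact mul_le_mul_of_nonneg_left (pow_le_pow_right₀ hq1R hexp2) (by norm_num)
  by_cases hrP : (r : ℝ) = P
  · -- `r` IS the partial sum: the distance is the remainder `≥ b^{−(k+2)!} = D^{−(k+2)} ≥ q^{−(k+1)(k+2)}`
    rw [hℓ, hrP, add_sub_cancel_left, abs_of_pos hRpos]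
    refine le_trans ?_ hRge
    refine le_trans hfin1.le ?_
    apply one_div_le_one_div_of_le (by positivity)
    calc D ^ (k + 2) ≤ ((q : ℝ) ^ (k + 1)) ^ (k + 2) := pow_le_pow_left₀ hD0.le hDq _
      _ = (q : ℝ) ^ ((k + 1) * (k + 2)) := by rw [← pow_mul]
  · -- `r ≠ P`: `|r − P| ≥ 1/(qD)` (a non-zero integer over `qD`), and `R < 1/(2qD)`
    set N : ℤ := r.num * (b : ℤ) ^ (k + 1).factorial - (p : ℤ) * q with hN
    have hrq : (r : ℝ) = (r.num : ℝ) / q := by rw [hqdef]; exact_mod_cast r.num_div_den.symm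
    have hdiff : (r : ℝ) - P = (N : ℝ) / (q * D) := by
      rw [hrq, hp, hN, hD]
      push_cast
      field_simp
    have hN0 : N ≠ 0 := by
      intro h0
      apply hrP
      have : (r : ℝ) - P = 0 := by rw [hdiff, h0]; simp
      linarith
    have hN1 : (1 : ℝ) ≤ |(N : ℝ)| := by exact_mod_cast Int.one_le_abs hN0
    have hsep : 1 / (q * D) ≤ |(r : ℝ) - P| := by
      rw [hdiff, abs_div, abs_of_pos (by positivity : (0 : ℝ) < q * D)]
      exact div_le_div_of_nonneg_right hN1 (by positivity)
    have hR2 : R ≤ 1 / (2 * (q * D)) := by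
      refine hRlt.le.trans ?_
      apply one_div_le_one_div_of_le (by positivity)
      nlinarith [hqD', hq0R]
    -- `|ℓ − r| ≥ |r − P| − R ≥ 1/(2qD) ≥ 1/(2 q^{k+2})`
    have htri : |(r : ℝ) - P| - R ≤ |liouvilleNumber b - r| := by
      rw [hℓ]
      have e : P + R - (r : ℝ) = R - ((r : ℝ) - P) := by ring
      rw [e, abs_sub_comm R ((r : ℝ) - P)]
      have h1 := abs_sub_abs_le_abs_sub ((r : ℝ) - P) R
      rw [abs_of_pos hRpos] at h1
      exact h1
    refine le_trans ?_ htri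
    refine le_trans hfin2.le ?_
    have hqD2 : 1 / (2 * (q : ℝ) ^ (k + 2)) ≤ 1 / (2 * (q * D)) := by
      apply one_div_le_one_div_of_le (by positivity)
      have : (q : ℝ) * D ≤ (q : ℝ) ^ (k + 2) := by
        rw [pow_succ']
        exact mul_le_mul_of_nonneg_left hDq hq0R.le
      linarith
    have : 1 / (2 * ((q : ℝ) * D)) = 1 / (q * D) - 1 / (2 * (q * D)) := by
      field_simp; ring
    linarith

/-- §17e. Liouville's own numbers Σ_i b^{−i!} are Liouville but NOT hyper-Liouville: auxiliary statement `two_le_exp_one` (lens 6 gen 9 node, ported verbatim). -/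
private theorem two_le_exp_one : (2 : ℝ) ≤ Real.exp 1 := by linarith [Real.add_one_le_exp (1 : ℝ)]

/-- **Liouville's numbers are not hyper-Liouville** (`b ≥ 2`). -/
theorem not_hyperLiouville_liouvilleNumber {b : ℕ} (hb : 2 ≤ b) :
    ¬ HyperLiouville (liouvilleNumber b) := by
  intro hH
  obtain ⟨r, hden, -, hlt⟩ := hH (b + 4)
  set q : ℕ := r.den with hq
  have hqb : b ≤ q := by omega
  have hq4 : 4 ≤ q := by omega
  have hq1R : (1 : ℝ) ≤ q := by exact_mod_cast (show 1 ≤ q by omega)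
  have hq4R : (4 : ℝ) ≤ q := by exact_mod_cast hq4
  have hlow := liouvilleNumber_sub_rat_lower hb r hqb
  -- `exp(−q^{b+4}) ≤ exp(−q⁴) ≤ 1 / (2 q^{3q²})`
  have h1 : Real.exp (-((q : ℝ) ^ (b + 4))) ≤ Real.exp (-((q : ℝ) ^ 4)) :=
    Real.exp_le_exp.mpr (neg_le_neg (pow_le_pow_right₀ hq1R (by omega)))
  have h2 : 2 * (q : ℝ) ^ (3 * q ^ 2) ≤ Real.exp ((q : ℝ) ^ 4) := by
    have hqexp : (q : ℝ) ≤ Real.exp q := by linarith [Real.add_one_le_exp (q : ℝ)]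
    have h2e : (2 : ℝ) ≤ Real.exp q :=
      two_le_exp_one.trans (Real.exp_le_exp.mpr hq1R)
    calc 2 * (q : ℝ) ^ (3 * q ^ 2) ≤ Real.exp q * (Real.exp q) ^ (3 * q ^ 2) := by
          gcongr
      _ = Real.exp ((q : ℝ) + (3 * q ^ 2 : ℕ) * q) := by
          rw [Real.exp_add, Real.exp_nat_mul]
      _ ≤ Real.exp ((q : ℝ) ^ 4) := by
          apply Real.exp_le_exp.mpr
          push_cast
          nlinarith [hq4R, pow_nonneg (by positivity : (0:ℝ) ≤ q) 2,
            mul_nonneg (by linarith : (0:ℝ) ≤ q - 4) (pow_nonneg (by positivity : (0:ℝ) ≤ q) 3)]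
  have h3 : Real.exp (-((q : ℝ) ^ 4)) ≤ 1 / (2 * (q : ℝ) ^ (3 * q ^ 2)) := by
    rw [Real.exp_neg, ← one_div]
    exact one_div_le_one_div_of_le (by positivity) h2
  linarith

/-- In particular `liouvilleNumber b` is LIOUVILLE (Mathlib) and NOT hyper-Liouville: the
two classes are distinct, witnessed by named constants on both sides (`λ_H`, §17d). -/
theorem liouville_not_hyperLiouville_liouvilleNumber {b : ℕ} (hb : 2 ≤ b) :
    Liouville (liouvilleNumber b) ∧ ¬ HyperLiouville (liouvilleNumber b) :=
  ⟨liouville_liouvilleNumber hb, not_hyperLiouville_liouvilleNumber hb⟩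

/-- **Piece A₄ʰ — `HyperLiouvilleSchanuel`** (crux, round 4; child 1 of the cut of A₃ =
`LinLiouvilleSchanuel`): Schanuel's bound for the ℚ-linearly independent `z : Fin n → ℂ` that are
HYPER-LIOUVILLE AS LINEAR FORMS — for every `m` some non-zero `h ∈ ℤⁿ` has
`‖Σ hᵢzᵢ‖ < exp(−(1 + Σ|hᵢ|)^m)`. -/
def HyperLiouvilleSchanuel : Prop :=
  ∀ (n : ℕ) (z : Fin n → ℂ), LinearIndependent ℚ z →
    (∀ m : ℕ, ∃ h : Fin n → ℤ, h ≠ 0 ∧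
      ‖∑ i, (h i : ℂ) * z i‖ < Real.exp (-((1 + ∑ i, (|h i| : ℝ)) ^ m))) →
    (n : Cardinal) ≤ Algebra.trdeg ℚ ↥(IntermediateField.adjoin ℚ (Set.range z ∪ Set.range (Complex.exp ∘ z)))

/-- **Piece A₄ᵈ — `FiniteOrderLiouvilleSchanuel`** (crux, round 4; child 2 = the RESIDUAL of A₃):
Schanuel's bound for the ℚ-linearly independent `z : Fin n → ℂ` that are Liouville as linear
forms (every polynomial order) but NOT hyper-Liouville (some exponential order fails). -/
def FiniteOrderLiouvilleSchanuel : Prop :=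
  ∀ (n : ℕ) (z : Fin n → ℂ), LinearIndependent ℚ z →
    (∀ ω : ℕ, ∃ h : Fin n → ℤ, h ≠ 0 ∧ ‖∑ i, (h i : ℂ) * z i‖ < 1 / (1 + ∑ i, (|h i| : ℝ)) ^ ω) →
    (¬ ∀ m : ℕ, ∃ h : Fin n → ℤ, h ≠ 0 ∧
      ‖∑ i, (h i : ℂ) * z i‖ < Real.exp (-((1 + ∑ i, (|h i| : ℝ)) ^ m))) →
    (n : Cardinal) ≤ Algebra.trdeg ℚ ↥(IntermediateField.adjoin ℚ (Set.range z ∪ Set.range (Complex.exp ∘ z)))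

/-- §17f. ROUND 4 — the pieces A₄ʰ / A₄ᵈ of A₃, the glue, the node closes₅, exactness: auxiliary statement `hyperLiouvilleSchanuel_iff` (lens 6 gen 9 node, ported verbatim). -/
theorem hyperLiouvilleSchanuel_iff :
    HyperLiouvilleSchanuel ↔
      ∀ (n : ℕ) (z : Fin n → ℂ), LinearIndependent ℚ z → HyperLinLiouville z → SB n z :=
  Iff.rfl

/-- §17f. ROUND 4 — the pieces A₄ʰ / A₄ᵈ of A₃, the glue, the node closes₅, exactness: auxiliary statement `finiteOrderLiouvilleSchanuel_iff` (lens 6 gen 9 node, ported verbatim). -/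
theorem finiteOrderLiouvilleSchanuel_iff :
    FiniteOrderLiouvilleSchanuel ↔
      ∀ (n : ℕ) (z : Fin n → ℂ), LinearIndependent ℚ z → LinLiouville z →
        ¬ HyperLinLiouville z → SB n z :=
  Iff.rfl

/-- **GLUE of the cut `LinLiouvilleSchanuel ⟸ HyperLiouvilleSchanuel ∧ FiniteOrderLiouvilleSchanuel`**
(excluded middle on `HyperLinLiouville z`). -/
theorem linLiouvilleSchanuel_of_pieces₄ (hH : HyperLiouvilleSchanuel)
    (hF : FiniteOrderLiouvilleSchanuel) : LinLiouvilleSchanuel := by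
  intro n z hz hL
  by_cases hy : ∀ m : ℕ, ∃ h : Fin n → ℤ, h ≠ 0 ∧
      ‖∑ i, (h i : ℂ) * z i‖ < Real.exp (-((1 + ∑ i, (|h i| : ℝ)) ^ m))
  · exact hH n z hz hy
  · exact hF n z hz hL hy

/-- The glue as one Prop (shape the gate files for a split of A₃), and its proof. -/
def LinLiouvilleSchanuelGlue : Prop :=
  HyperLiouvilleSchanuel → FiniteOrderLiouvilleSchanuel → LinLiouvilleSchanuel

/-- §17f. ROUND 4 — the pieces A₄ʰ / A₄ᵈ of A₃, the glue, the node closes₅, exactness: auxiliary statement `linLiouvilleSchanuelGlue_holds` (lens 6 gen 9 node, ported verbatim). -/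
theorem linLiouvilleSchanuelGlue_holds : LinLiouvilleSchanuelGlue :=
  linLiouvilleSchanuel_of_pieces₄

/-- **3-child GLUE into the round-2 residual** (shape of a `--resplit StrictDiophantineSchanuel
--into HyperLiouvilleSchanuel FiniteOrderLiouvilleSchanuel PolyDiophantineSchanuel`):
`A₄ʰ → A₄ᵈ → B₃ → S_D′`, proved (round-4 glue composed with the CLOSED round-3 glue 31988). -/
theorem strictDiophantineSchanuel_of_pieces₄ (hH : HyperLiouvilleSchanuel)
    (hF : FiniteOrderLiouvilleSchanuel) (hB : PolyDiophantineSchanuel) :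
    StrictDiophantineSchanuel :=
  strictDiophantineSchanuel_of_pieces₃ (linLiouvilleSchanuel_of_pieces₄ hH hF) hB

/-- §17f. ROUND 4 — the pieces A₄ʰ / A₄ᵈ of A₃, the glue, the node closes₅, exactness: auxiliary statement `StrictDiophantineSchanuelGlue₄` (lens 6 gen 9 node, ported verbatim). -/
def StrictDiophantineSchanuelGlue₄ : Prop :=
  HyperLiouvilleSchanuel → FiniteOrderLiouvilleSchanuel → PolyDiophantineSchanuel →
    StrictDiophantineSchanuel

/-- §17f. ROUND 4 — the pieces A₄ʰ / A₄ᵈ of A₃, the glue, the node closes₅, exactness: auxiliary statement `strictDiophantineSchanuelGlue₄_holds` (lens 6 gen 9 node, ported verbatim). -/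
theorem strictDiophantineSchanuelGlue₄_holds : StrictDiophantineSchanuelGlue₄ :=
  strictDiophantineSchanuel_of_pieces₄

/-- The same glue WITHOUT node lemmas (the port a prover lands: three `by_cases`). -/
theorem strictDiophantineSchanuel_of_pieces₄' (hH : HyperLiouvilleSchanuel)
    (hF : FiniteOrderLiouvilleSchanuel) (hB : PolyDiophantineSchanuel) :
    StrictDiophantineSchanuel := by
  intro n z hz hD
  by_cases hA : ∀ ω : ℕ, ∃ h : Fin n → ℤ, h ≠ 0 ∧
      ‖∑ i, (h i : ℂ) * z i‖ < 1 / (1 + ∑ i, (|h i| : ℝ)) ^ ω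
  · by_cases hy : ∀ m : ℕ, ∃ h : Fin n → ℤ, h ≠ 0 ∧
        ‖∑ i, (h i : ℂ) * z i‖ < Real.exp (-((1 + ∑ i, (|h i| : ℝ)) ^ m))
    · exact hH n z hz hy
    · exact hF n z hz hA hy
  · exact hB n z hz hD hA

/-- **Deciding theorem, round 4.** `S_L′ → A₄ʰ → A₄ᵈ → B₃ → Schanuel`. -/
theorem closes₅ (hL : CoordLiouvilleSchanuel) (hH : HyperLiouvilleSchanuel)
    (hF : FiniteOrderLiouvilleSchanuel) (hB : PolyDiophantineSchanuel) : _root_.Schanuel :=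
  closes₄ hL (linLiouvilleSchanuel_of_pieces₄ hH hF) hB

/-- The flat 4-binder deciding theorem (the writer's PATH A″ `closes`, no node lemma). -/
theorem closes₅' (hL : CoordLiouvilleSchanuel) (hH : HyperLiouvilleSchanuel)
    (hF : FiniteOrderLiouvilleSchanuel) (hB : PolyDiophantineSchanuel) : _root_.Schanuel := by
  intro n z hz
  by_cases h : ∃ w ∈ Submodule.span ℚ (Set.range z), Liouville w.re ∨ Liouville w.im
  · exact hL n z hz h
  · by_cases hA : ∀ ω : ℕ, ∃ h : Fin n → ℤ, h ≠ 0 ∧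
        ‖∑ i, (h i : ℂ) * z i‖ < 1 / (1 + ∑ i, (|h i| : ℝ)) ^ ω
    · by_cases hy : ∀ m : ℕ, ∃ h : Fin n → ℤ, h ≠ 0 ∧
          ‖∑ i, (h i : ℂ) * z i‖ < Real.exp (-((1 + ∑ i, (|h i| : ℝ)) ^ m))
      · exact hH n z hz hy
      · exact hF n z hz hA hy
    · exact hB n z hz h hA

end HyperCell

end Summit.Schanuel.Schanuel.Theorems.RootDecomp1KHyper
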